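import Mathlib.LinearAlgebra.FiniteDimensional.Lemmas
import Literature.Computability.AlgebraicComplexity.OneOneOneEquations
import Literature.Computability.AlgebraicComplexity.JelisiejewLandsbergPal2023MinimalBorderRank
import Literature.Computability.AlgebraicComplexity.QuantumFunctionalsDirectSumMarginals
import Literature.Computability.AlgebraicComplexity.BorderRankCW
import HarnessLib

/-!
# The 111-space of a direct sum of concise tensors splits (sub-additivity of `dim 𝔞`)

Sub-problem `MatrixMultiplication` (solo line `solo-MatrixMultiplication-informed`, gen 17;
catalyst door, `SoloInformedCatalystDoor.lean`).  For tensors `T ∈ K^ι ⊗ K^κ ⊗ K^μ`,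
`s ∈ K^ι' ⊗ K^κ' ⊗ K^μ'` concise in all three legs (`IsConcise3`, Jelisiejew–Landsberg–Pal 2023
§1.1) the 111-space `𝔞(T ⊕ s) = ker (lin111 (T ⊕ s))` (triples `(P,Q,R)` with
`P ·₁ (T ⊕ s) = Q ·₂ (T ⊕ s) = R ·₃ (T ⊕ s)`, `MatMulDirectSumCubicFormat.lean`) embeds into
`𝔞(T) × 𝔞(s)`: the off-diagonal blocks of `P, Q, R` vanish by conciseness and the diagonal
blocks lie in the 111-spaces of the summands.  Hence

* `finrank_ker_lin111_directSum_le` — `dim 𝔞(T ⊕ s) ≤ dim 𝔞(T) + dim 𝔞(s)`;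
* `isConcise3_directSumTensor` — a direct sum of concise tensors is concise;
* `linearIndependent_rotate_of_isUnit_contractFirst` (+ `…rotate_rotate…`) — a tensor with an
  invertible first-factor slice `T(α)` (a `1_A`-generic tensor) is `B`- and `C`-concise;
* `rotate_directSumTensor`, `rotate_kroneckerPow`, `rotate_cwTensor` — cyclic symmetry bookkeeping.

Used in `SoloInformedCatalystAbundance.lean`: a finite catalyst certificate
`bR(T_cw,2^{⊠N} ⊕ s) ≤ 3^N + d` for a concise `d × d × d` catalyst `s` forces `dim 𝔞(s) > d`
(111-abundant and not 111-sharp), an object not known to exist (JLP 2023, §1.4.1).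
Elementary linear algebra over any field; 0 sorries.

References: J. Jelisiejew, J. M. Landsberg, A. Pal, *Concise tensors of minimal border rank*,
Math. Ann. 388 (2023), arXiv:2205.05713, §1.1 (conciseness, 111-abundance), Ex. 2.2 (direct
sums) [JelisiejewLandsbergPal2023]; W. Buczyńska, J. Buczyński, Duke Math. J. 170 (2021),
Thm. 1.2 [BuczynskaBuczynski2021].
-/

noncomputable section

open scoped BigOperators Matrix
open Matrix

namespace Summit.MatrixMultiplication.MatrixMultiplication.Theorems

open Literature.Computability.AlgebraicComplexity

universe u

namespace OneOneOneSplit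

variable {K : Type u} [Field K]
variable {ι κ μ ι' κ' μ' : Type*} [Fintype ι] [Fintype κ] [Fintype μ] [Fintype ι']
  [Fintype κ'] [Fintype μ'] [DecidableEq ι] [DecidableEq κ] [DecidableEq μ] [DecidableEq ι']
  [DecidableEq κ'] [DecidableEq μ']

/-! ## Cyclic symmetry bookkeeping -/

omit [Fintype ι] [Fintype κ] [Fintype μ] [Fintype ι'] [Fintype κ'] [Fintype μ']
  [DecidableEq ι] [DecidableEq κ] [DecidableEq μ] [DecidableEq ι'] [DecidableEq κ']
  [DecidableEq μ'] in
/-- `rotate` commutes with direct sums. [folklore] -/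
theorem rotate_directSumTensor (T : ι → κ → μ → K) (s : ι' → κ' → μ' → K) :
    rotate (directSumTensor T s) = directSumTensor (rotate T) (rotate s) := by
  funext b c a
  rcases a with a | a <;> rcases b with b | b <;> rcases c with c | c <;> rfl

omit [Fintype ι] [Fintype κ] [Fintype μ] [DecidableEq ι] [DecidableEq κ] [DecidableEq μ] in
/-- `rotate` commutes with Kronecker powers. [folklore] -/
theorem rotate_kroneckerPow (t : ι → κ → μ → K) (N : ℕ) :
    rotate (kroneckerPow t N) = kroneckerPow (rotate t) N := rfl

/-- The little Coppersmith–Winograd tensor is cyclically symmetric.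
[cite: ConnerGesmundoLandsbergVentura2022, eq. (1)] -/
theorem rotate_cwTensor (q : ℕ) : rotate (cwTensor K q) = cwTensor K q := by
  funext b c a
  simp only [rotate, cwTensor_apply]
  by_cases ha : a = 0 <;> by_cases hb : b = 0 <;> by_cases hc : c = 0 <;> simp [ha, hb, hc] <;>
    exact if_congr eq_comm rfl rfl

/-! ## Conciseness -/

omit [Fintype κ] [Fintype μ] [Fintype κ'] [Fintype μ'] [DecidableEq ι] [DecidableEq κ]
  [DecidableEq μ] [DecidableEq ι'] [DecidableEq κ'] [DecidableEq μ'] in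
/-- The first-leg slices of a direct sum of `A`-concise tensors are linearly independent.
[folklore] -/
theorem linearIndependent_directSumTensor (T : ι → κ → μ → K) (s : ι' → κ' → μ' → K)
    (hT : LinearIndependent K fun i => T i) (hs : LinearIndependent K fun i => s i) :
    LinearIndependent K fun z => directSumTensor T s z := by
  rw [Fintype.linearIndependent_iff] at hT hs ⊢
  intro g hg
  have hl : ∀ i, g (Sum.inl i) = 0 := by
    refine hT (fun i => g (Sum.inl i)) ?_
    funext x y
    have h := congr_fun (congr_fun hg (Sum.inl x)) (Sum.inl y)
    simpa [Finset.sum_apply, Fintype.sum_sum_type] using h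
  have hr : ∀ i, g (Sum.inr i) = 0 := by
    refine hs (fun i => g (Sum.inr i)) ?_
    funext x y
    have h := congr_fun (congr_fun hg (Sum.inr x)) (Sum.inr y)
    simpa [Finset.sum_apply, Fintype.sum_sum_type] using h
  rintro (i | i)
  exacts [hl i, hr i]

omit [DecidableEq ι] [DecidableEq κ] [DecidableEq μ] [DecidableEq ι'] [DecidableEq κ']
  [DecidableEq μ'] in
/-- A direct sum of concise tensors is concise. [cite: JelisiejewLandsbergPal2023, §1.1] -/
theorem isConcise3_directSumTensor {T : ι → κ → μ → K} {s : ι' → κ' → μ' → K}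
    (hT : IsConcise3 T) (hs : IsConcise3 s) : IsConcise3 (directSumTensor T s) := by
  refine ⟨linearIndependent_directSumTensor T s hT.1 hs.1, ?_, ?_⟩
  · rw [rotate_directSumTensor]
    exact linearIndependent_directSumTensor _ _ hT.2.1 hs.2.1
  · rw [rotate_directSumTensor, rotate_directSumTensor]
    exact linearIndependent_directSumTensor _ _ hT.2.2 hs.2.2

omit [Fintype μ] [DecidableEq ι] [DecidableEq μ] in
/-- A tensor with an invertible first-factor slice `T(α)` is `B`-concise.
[cite: JelisiejewLandsbergPal2023, §1.1] -/
theorem linearIndependent_rotate_of_isUnit_contractFirst (t : ι → κ → κ → K) (α : ι → K)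
    (hα : IsUnit (contractFirst α t)) : LinearIndependent K fun x => rotate t x := by
  rw [Fintype.linearIndependent_iff]
  intro g hg
  have hzero : ∀ z y, ∑ x, g x * t z x y = 0 := by
    intro z y
    have h := congr_fun (congr_fun hg y) z
    simpa [Finset.sum_apply, rotate] using h
  have hvec :
      Matrix.vecMul g (contractFirst α t) = Matrix.vecMul 0 (contractFirst α t) := by
    rw [Matrix.zero_vecMul]
    funext y
    simp only [Matrix.vecMul, dotProduct, contractFirst_apply, Pi.zero_apply, Finset.mul_sum]
    rw [Finset.sum_comm]
    calc ∑ i, ∑ x, g x * (α i * t i x y) = ∑ i, α i * ∑ x, g x * t i x y := by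
          refine Finset.sum_congr rfl fun i _ => ?_
          rw [Finset.mul_sum]
          exact Finset.sum_congr rfl fun x _ => by ring
      _ = 0 := by simp [hzero]
  exact congr_fun ((Matrix.vecMul_injective_iff_isUnit.2 hα) hvec)

omit [Fintype μ] [DecidableEq ι] [DecidableEq μ] in
/-- A tensor with an invertible first-factor slice `T(α)` is `C`-concise.
[cite: JelisiejewLandsbergPal2023, §1.1] -/
theorem linearIndependent_rotate_rotate_of_isUnit_contractFirst (t : ι → κ → κ → K)
    (α : ι → K) (hα : IsUnit (contractFirst α t)) :
    LinearIndependent K fun y => rotate (rotate t) y := by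
  rw [Fintype.linearIndependent_iff]
  intro g hg
  have hzero : ∀ z x, ∑ y, g y * t z x y = 0 := by
    intro z x
    have h := congr_fun (congr_fun hg z) x
    simpa [Finset.sum_apply, rotate] using h
  have hvec :
      Matrix.mulVec (contractFirst α t) g = Matrix.mulVec (contractFirst α t) 0 := by
    rw [Matrix.mulVec_zero]
    funext x
    simp only [Matrix.mulVec, dotProduct, contractFirst_apply, Pi.zero_apply, Finset.sum_mul]
    rw [Finset.sum_comm]
    calc ∑ i, ∑ y, α i * t i x y * g y = ∑ i, α i * ∑ y, g y * t i x y := by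
          refine Finset.sum_congr rfl fun i _ => ?_
          rw [Finset.mul_sum]
          exact Finset.sum_congr rfl fun y _ => by ring
      _ = 0 := by simp [hzero]
  exact congr_fun ((Matrix.mulVec_injective_iff_isUnit.2 hα) hvec)

/-! ## The blocks of a triple on a direct sum -/

/-- The diagonal embedding of the index triples of the first summand. [folklore] -/
def embL : TripleIndex ι κ μ → TripleIndex (ι ⊕ ι') (κ ⊕ κ') (μ ⊕ μ') :=
  Sum.map (Prod.map Sum.inl Sum.inl)
    (Sum.map (Prod.map Sum.inl Sum.inl) (Prod.map Sum.inl Sum.inl))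

/-- The diagonal embedding of the index triples of the second summand. [folklore] -/
def embR : TripleIndex ι' κ' μ' → TripleIndex (ι ⊕ ι') (κ ⊕ κ') (μ ⊕ μ') :=
  Sum.map (Prod.map Sum.inr Sum.inr)
    (Sum.map (Prod.map Sum.inr Sum.inr) (Prod.map Sum.inr Sum.inr))

omit [DecidableEq ι] [DecidableEq κ] [DecidableEq μ] [DecidableEq ι'] [DecidableEq κ']
  [DecidableEq μ'] in
/-- **Block structure of the 111-space of a direct sum.**  If `(P,Q,R) ∈ 𝔞(T ⊕ s)` with `T`, `s`
concise, then the diagonal blocks lie in `𝔞(T)`, `𝔞(s)` and the six off-diagonal blocks vanish.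
[cite: JelisiejewLandsbergPal2023, §1.1] -/
theorem blocks_of_lin111_directSum_eq_zero {T : ι → κ → μ → K} {s : ι' → κ' → μ' → K}
    (hT : IsConcise3 T) (hs : IsConcise3 s) {c : TripleIndex (ι ⊕ ι') (κ ⊕ κ') (μ ⊕ μ') → K}
    (h : lin111 (directSumTensor T s) c = 0) :
    lin111 T (c ∘ embL) = 0 ∧ lin111 s (c ∘ embR) = 0 ∧
      (∀ i' i, c (Sum.inl (Sum.inr i', Sum.inl i)) = 0) ∧
      (∀ i i', c (Sum.inl (Sum.inl i, Sum.inr i')) = 0) ∧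
      (∀ j' j, c (Sum.inr (Sum.inl (Sum.inr j', Sum.inl j))) = 0) ∧
      (∀ j j', c (Sum.inr (Sum.inl (Sum.inl j, Sum.inr j'))) = 0) ∧
      (∀ k' k, c (Sum.inr (Sum.inr (Sum.inr k', Sum.inl k))) = 0) ∧
      (∀ k k', c (Sum.inr (Sum.inr (Sum.inl k, Sum.inr k'))) = 0) := by
  obtain ⟨hPQ, hQR⟩ := (lin111_eq_zero_iff _ c).1 h
  have ev := fun z x y => congr_fun (congr_fun (congr_fun hPQ z) x) y
  have ev' := fun z x y => congr_fun (congr_fun (congr_fun hQR z) x) y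
  refine ⟨?_, ?_, ?_, ?_, ?_, ?_, ?_, ?_⟩
  · refine (lin111_eq_zero_iff T _).2 ⟨?_, ?_⟩
    · funext i j k
      have e := ev (Sum.inl i) (Sum.inl j) (Sum.inl k)
      simpa [contract₁_apply, contract₂_apply, Fintype.sum_sum_type, embL] using e
    · funext i j k
      have e := ev' (Sum.inl i) (Sum.inl j) (Sum.inl k)
      simpa [contract₂_apply, contract₃_apply, Fintype.sum_sum_type, embL] using e
  · refine (lin111_eq_zero_iff s _).2 ⟨?_, ?_⟩
    · funext i j k
      have e := ev (Sum.inr i) (Sum.inr j) (Sum.inr k)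
      simpa [contract₁_apply, contract₂_apply, Fintype.sum_sum_type, embR] using e
    · funext i j k
      have e := ev' (Sum.inr i) (Sum.inr j) (Sum.inr k)
      simpa [contract₂_apply, contract₃_apply, Fintype.sum_sum_type, embR] using e
  · intro i'
    refine Fintype.linearIndependent_iff.1 hT.1
      (fun i => c (Sum.inl (Sum.inr i', Sum.inl i))) ?_
    funext j k
    have e := ev (Sum.inr i') (Sum.inl j) (Sum.inl k)
    simpa [contract₁_apply, contract₂_apply, Fintype.sum_sum_type, Finset.sum_apply] using e
  · intro i
    refine Fintype.linearIndependent_iff.1 hs.1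
      (fun i' => c (Sum.inl (Sum.inl i, Sum.inr i'))) ?_
    funext j k
    have e := ev (Sum.inl i) (Sum.inr j) (Sum.inr k)
    simpa [contract₁_apply, contract₂_apply, Fintype.sum_sum_type, Finset.sum_apply] using e
  · intro j'
    refine Fintype.linearIndependent_iff.1 hT.2.1
      (fun j => c (Sum.inr (Sum.inl (Sum.inr j', Sum.inl j)))) ?_
    funext k i
    have e := ev' (Sum.inl i) (Sum.inr j') (Sum.inl k)
    simpa [contract₂_apply, contract₃_apply, Fintype.sum_sum_type, Finset.sum_apply, rotate]
      using e
  · intro j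
    refine Fintype.linearIndependent_iff.1 hs.2.1
      (fun j' => c (Sum.inr (Sum.inl (Sum.inl j, Sum.inr j')))) ?_
    funext k i
    have e := ev' (Sum.inr i) (Sum.inl j) (Sum.inr k)
    simpa [contract₂_apply, contract₃_apply, Fintype.sum_sum_type, Finset.sum_apply, rotate]
      using e
  · intro k'
    refine Fintype.linearIndependent_iff.1 hT.2.2
      (fun k => c (Sum.inr (Sum.inr (Sum.inr k', Sum.inl k)))) ?_
    funext i j
    have e := (ev' (Sum.inl i) (Sum.inl j) (Sum.inr k')).symm
    simpa [contract₂_apply, contract₃_apply, Fintype.sum_sum_type, Finset.sum_apply, rotate]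
      using e
  · intro k
    refine Fintype.linearIndependent_iff.1 hs.2.2
      (fun k' => c (Sum.inr (Sum.inr (Sum.inl k, Sum.inr k')))) ?_
    funext i j
    have e := (ev' (Sum.inr i) (Sum.inr j) (Sum.inl k)).symm
    simpa [contract₂_apply, contract₃_apply, Fintype.sum_sum_type, Finset.sum_apply, rotate]
      using e

omit [DecidableEq ι] [DecidableEq κ] [DecidableEq μ] [DecidableEq ι'] [DecidableEq κ']
  [DecidableEq μ'] in
/-- **Sub-additivity of the 111-space under direct sums** of concise tensors:
`dim 𝔞(T ⊕ s) ≤ dim 𝔞(T) + dim 𝔞(s)`. [cite: JelisiejewLandsbergPal2023, §1.1, Ex. 2.2] -/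
theorem finrank_ker_lin111_directSum_le {T : ι → κ → μ → K} {s : ι' → κ' → μ' → K}
    (hT : IsConcise3 T) (hs : IsConcise3 s) :
    Module.finrank K (LinearMap.ker (lin111 (directSumTensor T s))) ≤
      Module.finrank K (LinearMap.ker (lin111 T)) +
        Module.finrank K (LinearMap.ker (lin111 s)) := by
  set D := directSumTensor T s with hD
  let fL : LinearMap.ker (lin111 D) →ₗ[K] LinearMap.ker (lin111 T) :=
    LinearMap.codRestrict _
      ((LinearMap.funLeft K K embL).comp (LinearMap.ker (lin111 D)).subtype)
      fun c => (blocks_of_lin111_directSum_eq_zero hT hs c.2).1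
  let fR : LinearMap.ker (lin111 D) →ₗ[K] LinearMap.ker (lin111 s) :=
    LinearMap.codRestrict _
      ((LinearMap.funLeft K K embR).comp (LinearMap.ker (lin111 D)).subtype)
      fun c => (blocks_of_lin111_directSum_eq_zero hT hs c.2).2.1
  have hinj : Function.Injective (fL.prod fR) := by
    refine (injective_iff_map_eq_zero _).2 fun c hc => ?_
    have hcL : fL c = 0 := by simpa using congrArg Prod.fst hc
    have hcR : fR c = 0 := by simpa using congrArg Prod.snd hc
    have hL : ∀ t, c.1 (embL t) = 0 := fun t => by
      simpa [fL] using congr_fun (congrArg Subtype.val hcL) t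
    have hR : ∀ t, c.1 (embR t) = 0 := fun t => by
      simpa [fR] using congr_fun (congrArg Subtype.val hcR) t
    obtain ⟨-, -, h1, h2, h3, h4, h5, h6⟩ := blocks_of_lin111_directSum_eq_zero hT hs c.2
    apply Subtype.ext
    funext t
    rcases t with ⟨z | z, z' | z'⟩ | ⟨x | x, x' | x'⟩ | ⟨y | y, y' | y'⟩
    · exact hL (Sum.inl (z, z'))
    · exact h2 z z'
    · exact h1 z z'
    · exact hR (Sum.inl (z, z'))
    · exact hL (Sum.inr (Sum.inl (x, x')))
    · exact h4 x x'
    · exact h3 x x'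
    · exact hR (Sum.inr (Sum.inl (x, x')))
    · exact hL (Sum.inr (Sum.inr (y, y')))
    · exact h6 y y'
    · exact h5 y y'
    · exact hR (Sum.inr (Sum.inr (y, y')))
  calc Module.finrank K (LinearMap.ker (lin111 D))
      ≤ Module.finrank K (LinearMap.ker (lin111 T) × LinearMap.ker (lin111 s)) :=
        LinearMap.finrank_le_finrank_of_injective hinj
    _ = _ := Module.finrank_prod

end OneOneOneSplit

end Summit.MatrixMultiplication.MatrixMultiplication.Theorems

end
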